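/-
Copyright (c) 2026 the pub-hodgecm-mathlib formalisation cell (harness21).  Prover seat hodgecm-mathlib-K2Liu-p13 (g2), Track B «K2-LIT»,
#184♮ = hLiu418 = `stmt-HodgeConjecture-24832`; Road I v3 organ U1-CT-ind STAGE 2 (Q2), file F5-c (LEAD F0P6-plan (g14) 10:39:33Z ∕ 11:15:51Z «F4 → F5 → D-U1 stage 3 =»).
-/
import Summits.HodgeConjecture.HodgeConjecture.Theorems.K2LiuKlingenUnipotentAdelicDefs     -- ★ F4-1: `jAdelic`, `coe_adelicVal_jAdelic`, §1 block lemmas (+ ★ F3′, F4-0, F1)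
import HarnessLib

/-!
# Crux `HLiu418`, Road I v3, organ U1 stage 2 (Q2), file F5-c: THE KLINGEN-LEVI LAW OF THE INNER SECTION OF THE `ξ`-CELL —
# `F(Ψ(m_Q(a,b)) · x) = χ_s(Ψ(ξ m_Q(a,b) ξ⁻¹)) · δ_{a,b} · F(x)` for `b ∈ B₂(𝔸)`, `det_Δ(Ψ(ξ m_Q(a,b) ξ⁻¹)) = b₀₀ · σ(a)⁻¹`

Cell `hodgecm-mathlib`, crux item hLiu418 = `stmt-HodgeConjecture-24832`; squad K2 ∕ K2Liu; LEAD F0P6-plan (g14), co-dealer K2E5-plan (g7); prover K2Liu-p13 (g2).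
THEOREMS ONLY (no `def`, no instance, no notation, no named-fact hypothesis, no `sorry`); lane `--supports stmt-HodgeConjecture-24832 --as helper` (count-neutral).
HYPOTHESIS-FIRST (the Klingen twin of K2Liu-p14 (g2)'s (β0-1b) `K2LiuMiddleInnerSectionBorelLaw`): after ★ F5-a `hasSum_cellXi` the `ξ`-cell of the Q-constant term is
`Σ_{[g′]} F(Ψ(m_Q(1,g′)) h)` with the INNER SECTION `F(x) = ∫ β₁ • f(Ψ(ξ) u x) dνN` over `N_Q(𝔸)`; integrating out the compact `u₊(L⁺)\u₊(𝔸)` (coordinates∕Haar, a later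
file) leaves `F(x) = ∫ f(Ψ(ξ) · Ψ(n_Q(y_p, 0, t_p)) · x) dμ(p)` over the two `ξ`-FLIPPED root groups `u_{2e₁}·u_{e₁−e₂}` (★ F4-0 §3) — taken here BY VALUE (`hF`) with an
abstract parameter space `(P, μ)` and coordinate maps `y_p` (skew), `t_p`.  THEN for `a ∈ 𝔸_L^×` and `b ∈ U(J₂)(𝔸)` UPPER TRIANGULAR (`b₁₀ = 0`; E1's Borel of `U(Φ₂)`):
* §0 (generic `R`, `σ` involutive) `upper_rel₁∕₂∕₃` (the unitarity relations of an upper-triangular `b ∈ U(J₂)`), **`nKlingen_mul_klingenLevi_of_upper`**: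
  `n_Q(y,0,t) · m_Q(a,b) = m_Q(a,b) · n_Q(y′, z′, t′)` with `t′ = a⁻¹ t b₀₀`, `z′ = a⁻¹ t b₀₁`, `y′ = a⁻¹σ(a)⁻¹ y + z′σ(t′)` (`skew_yPrime`), `nKlingen_eq_uPlus_mul`
  (`n_Q(y′,z′,t′) = u₊(z′) · n_Q(y′,0,t′)`), **`coe_weylXi_conj_klingenLevi_of_upper`** (`ξ m_Q(a,b) ξ⁻¹ = (b₀₀ 0 0 b₀₁; 0 σ(a)⁻¹ 0 0; 0 0 a 0; 0 0 0 b₁₁)`, upper triangular,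
  `e₂`-block `diag(b₀₀, σ(a)⁻¹)`);
* §1 (`n = 2`, ★ F3 clauses BY VALUE) `isSiegelDelta_transport_weylXi_conj_klingenLevi`, **`detDelta_transport_weylXi_conj_klingenLevi`** (`= b₀₀ · σ(a⁻¹)`: the exponent
  bookkeeping of term 2 — `‖b₀₀‖^{s+1}` and `‖a‖^{−(s+1)}` BEFORE the substitution modulus `δ`), `apply_transport_weylXi_conj_uPlus_mul` (`Ψ(ξ u₊ ξ⁻¹)` is invisible);
* §2 **`klingenInner_levi_law`** — with the substitution `c : P → P`, `(y,t) ↦ (y′, t′)`, and its modulus `hscale : ∫ φ_x(c p) dμ = δ ∫ φ_x dμ` BY VALUE (Haar: `δ = ‖a‖²‖b₀₀‖⁻¹`-type,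
  dischargeable), `F(Ψ(m_Q(a,b)) x) = siegelDeltaCharacter χ s (Ψ(ξ m_Q(a,b) ξ⁻¹)) · δ · F(x)` — for `a = 1` this is the BOREL-SECTION law of `g′ ↦ F(Ψ(m_Q(1,g′)) x)` on
  `U(J₂)(𝔸)` at the parameter `s − ½` (E1's normalisation `χ(b₀₀)‖b₀₀‖^{s′+½}`), i.e. term 2 of `E_Q` is E1's Borel Eisenstein series of `i^*M(ξ,s)f` (file F5).
[MoeglinWaldspurger1995, II.1.7], [Xiong2013, §4 Prop. 4.1, §7 L. 7.1], [GanTakeda2011SiegelWeil, §7.2 p. 23], [Casselman1980, §3], [HarrisKudlaSweet1996, §1 (1.15)].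
HONEST LABEL.  Count-neutral helper: `HC_CM` is proved only modulo the 7 printed citations (2 remaining named inputs: hLiu418 = `stmt-HodgeConjecture-24832`,
h413 = `stmt-HodgeConjecture-24833`) until rung 0 closes.
-/

set_option autoImplicit false
set_option linter.dupNamespace false -- the mandated namespace repeats `HodgeConjecture.HodgeConjecture`

noncomputable section

open scoped Matrix
open NumberField IsDedekindDomain MeasureTheory

namespace Summit.HodgeConjecture.HodgeConjecture.Cruxes.HLiu418.K2LiuKlingenInnerSectionLeviLaw

open Literature.NumberTheory.Automorphic Literature.NumberTheory.Automorphic.UnitaryGroup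
open Literature.NumberTheory.GelbartRogawski1991 Literature.NumberTheory.GelbartRogawski1991.GRConstruction
open Literature.NumberTheory.GaloisRepresentations
open Literature.NumberTheory.K2Lit.SiegelDoubled
open Summit.HodgeConjecture.HodgeConjecture.Cruxes.HLiu418.K2LiuDoubledUTwoTwoBorelFrame
open Summit.HodgeConjecture.HodgeConjecture.Cruxes.HLiu418.K2LiuKlingenParabolicDefs
open Summit.HodgeConjecture.HodgeConjecture.Cruxes.HLiu418.K2LiuKlingenUnipotentDefs
open Summit.HodgeConjecture.HodgeConjecture.Cruxes.HLiu418.K2LiuKlingenUnipotentAdelicDefs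
open Summit.HodgeConjecture.HodgeConjecture.Cruxes.HLiu418.K2LiuDoubledAntidiagonalTransportLevi (detDelta_transport_of_blockTriangular apply_transport_mul)
open Summit.HodgeConjecture.HodgeConjecture.Cruxes.HLiu418.K2LiuSiegelDoubledLeviMatrix (conjAdele_conjAdele')
open UnitaryDualPair

/-! ## §0 Generic algebra: `n_Q(y,0,t) · m_Q(a,b) = m_Q(a,b) · u₊(z′) · n_Q(y′,0,t′)` and `ξ m_Q(a,b) ξ⁻¹` for upper-triangular `b` -/

section Generic

variable {R : Type*} [CommRing R] {σ : R →+* R}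

/-- unitarity of an upper-triangular `b ∈ U(J₂)`: `σ(b₀₀) b₁₁ = 1`. [cite: Rogawski1990, §1.9] -/
theorem upper_rel₁ {b : unitaryGroupOfForm σ ((StdForm.antidiagonal 2).over R)} (hb : ((b : GL (Fin 2) R) : Matrix (Fin 2) (Fin 2) R) 1 0 = 0) :
    σ (((b : GL (Fin 2) R) : Matrix (Fin 2) (Fin 2) R) 0 0) * ((b : GL (Fin 2) R) : Matrix (Fin 2) (Fin 2) R) 1 1 = 1 := by
  have h := (unitaryTwo_entries b).2.1
  rw [hb, map_zero, zero_mul, zero_add] at h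
  exact h

/-- unitarity of an upper-triangular `b ∈ U(J₂)`: `σ(b₁₁) b₀₀ = 1`. [cite: Rogawski1990, §1.9] -/
theorem upper_rel₂ {b : unitaryGroupOfForm σ ((StdForm.antidiagonal 2).over R)} (hb : ((b : GL (Fin 2) R) : Matrix (Fin 2) (Fin 2) R) 1 0 = 0) :
    σ (((b : GL (Fin 2) R) : Matrix (Fin 2) (Fin 2) R) 1 1) * ((b : GL (Fin 2) R) : Matrix (Fin 2) (Fin 2) R) 0 0 = 1 := by
  have h := (unitaryTwo_entries b).2.2.1
  rw [hb, mul_zero, add_zero] at h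
  exact h

/-- unitarity of an upper-triangular `b ∈ U(J₂)`: `b₀₁ σ(b₀₀) + σ(b₀₁) b₀₀ = 0` (`b₀₁σ(b₀₀)` is `σ`-skew). [cite: Rogawski1990, §1.9] -/
theorem upper_rel₃ {b : unitaryGroupOfForm σ ((StdForm.antidiagonal 2).over R)} (hb : ((b : GL (Fin 2) R) : Matrix (Fin 2) (Fin 2) R) 1 0 = 0) :
    ((b : GL (Fin 2) R) : Matrix (Fin 2) (Fin 2) R) 0 1 * σ (((b : GL (Fin 2) R) : Matrix (Fin 2) (Fin 2) R) 0 0) +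
      σ (((b : GL (Fin 2) R) : Matrix (Fin 2) (Fin 2) R) 0 1) * ((b : GL (Fin 2) R) : Matrix (Fin 2) (Fin 2) R) 0 0 = 0 := by
  have h4 := (unitaryTwo_entries b).2.2.2
  have h1 := upper_rel₁ hb
  have h2 := upper_rel₂ hb
  linear_combination (((b : GL (Fin 2) R) : Matrix (Fin 2) (Fin 2) R) 0 0 * σ (((b : GL (Fin 2) R) : Matrix (Fin 2) (Fin 2) R) 0 0)) * h4 -
    (((b : GL (Fin 2) R) : Matrix (Fin 2) (Fin 2) R) 0 1 * σ (((b : GL (Fin 2) R) : Matrix (Fin 2) (Fin 2) R) 0 0)) * h2 -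
    (σ (((b : GL (Fin 2) R) : Matrix (Fin 2) (Fin 2) R) 0 1) * ((b : GL (Fin 2) R) : Matrix (Fin 2) (Fin 2) R) 0 0) * h1

/-- the transported `y`-coordinate `y′ = a⁻¹σ(a)⁻¹ y + (a⁻¹ t b₀₁) σ(a⁻¹ t b₀₀)` is `σ`-skew. [cite: Xiong2013, §7 Lemma 7.1] -/
theorem skew_yPrime (hσ : ∀ x, σ (σ x) = x) (a : Rˣ) {b : unitaryGroupOfForm σ ((StdForm.antidiagonal 2).over R)}
    (hb : ((b : GL (Fin 2) R) : Matrix (Fin 2) (Fin 2) R) 1 0 = 0) {y : R} (hy : σ y = -y) (t : R) :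
    σ (((a⁻¹ : Rˣ) : R) * σ ((a⁻¹ : Rˣ) : R) * y +
        ((a⁻¹ : Rˣ) : R) * t * ((b : GL (Fin 2) R) : Matrix (Fin 2) (Fin 2) R) 0 1 * σ (((a⁻¹ : Rˣ) : R) * t * ((b : GL (Fin 2) R) : Matrix (Fin 2) (Fin 2) R) 0 0)) =
      -(((a⁻¹ : Rˣ) : R) * σ ((a⁻¹ : Rˣ) : R) * y +
        ((a⁻¹ : Rˣ) : R) * t * ((b : GL (Fin 2) R) : Matrix (Fin 2) (Fin 2) R) 0 1 * σ (((a⁻¹ : Rˣ) : R) * t * ((b : GL (Fin 2) R) : Matrix (Fin 2) (Fin 2) R) 0 0)) := by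
  have h3 := upper_rel₃ hb
  simp only [map_add, map_mul, hσ]
  linear_combination (((a⁻¹ : Rˣ) : R) * σ ((a⁻¹ : Rˣ) : R)) * hy +
    (((a⁻¹ : Rˣ) : R) * σ ((a⁻¹ : Rˣ) : R) * t * σ t) * h3

/-- **`n_Q(y,0,t) · m_Q(a,b) = m_Q(a,b) · n_Q(y′, z′, t′)`** for upper-triangular `b ∈ U(J₂)`, with `t′ = a⁻¹ t b₀₀`, `z′ = a⁻¹ t b₀₁`,
`y′ = a⁻¹σ(a)⁻¹ y + z′σ(t′)` (the Klingen Levi normalises `N_Q`; for upper-triangular `b` the subgroup `u_{2e₁}·u_{e₁−e₂}` is moved INTO `N_Q` with a `u₊`-component `z′`).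
[cite: Xiong2013, §7 Lemma 7.1] [cite: MoeglinWaldspurger1995, I.2.1] [cite: Casselman1980, §3] -/
theorem nKlingen_mul_klingenLevi_of_upper (hσ : ∀ x, σ (σ x) = x) (a : Rˣ) {b : unitaryGroupOfForm σ ((StdForm.antidiagonal 2).over R)}
    (hb : ((b : GL (Fin 2) R) : Matrix (Fin 2) (Fin 2) R) 1 0 = 0) (y : R) (hy : σ y = -y) (t : R) :
    nKlingen R σ hσ y hy 0 t * klingenLevi R σ hσ a b =
      klingenLevi R σ hσ a b *
        nKlingen R σ hσ
          (((a⁻¹ : Rˣ) : R) * σ ((a⁻¹ : Rˣ) : R) * y +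
            ((a⁻¹ : Rˣ) : R) * t * ((b : GL (Fin 2) R) : Matrix (Fin 2) (Fin 2) R) 0 1 * σ (((a⁻¹ : Rˣ) : R) * t * ((b : GL (Fin 2) R) : Matrix (Fin 2) (Fin 2) R) 0 0))
          (skew_yPrime hσ a hb hy t)
          (((a⁻¹ : Rˣ) : R) * t * ((b : GL (Fin 2) R) : Matrix (Fin 2) (Fin 2) R) 0 1)
          (((a⁻¹ : Rˣ) : R) * t * ((b : GL (Fin 2) R) : Matrix (Fin 2) (Fin 2) R) 0 0) := by
  have h1 := upper_rel₁ hb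
  have h3 := upper_rel₃ hb
  have hA : (a : R) * ((a⁻¹ : Rˣ) : R) = 1 := Units.mul_inv a
  apply ext_of_coe
  rw [Subgroup.coe_mul, Units.val_mul, Subgroup.coe_mul, Units.val_mul, coe_nKlingen, coe_klingenLevi, coe_nKlingen]
  ext i j
  fin_cases i <;> fin_cases j <;> simp [nKlingenM, klingenLeviM, Matrix.mul_apply, Fin.sum_univ_four, hb, map_mul] <;>
    first
    | linear_combination (-(t * ((b : GL (Fin 2) R) : Matrix (Fin 2) (Fin 2) R) 0 0)) * hA
    | linear_combination (-(t * ((b : GL (Fin 2) R) : Matrix (Fin 2) (Fin 2) R) 0 1)) * hA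
    | linear_combination (-(y * σ ((a⁻¹ : Rˣ) : R))) * hA
    | linear_combination (σ ((a⁻¹ : Rˣ) : R) * σ t) * h3
    | linear_combination (-(σ t * σ ((a⁻¹ : Rˣ) : R))) * h1

/-- **`n_Q(y, z, t) = u_{e₁+e₂}(z) · n_Q(y, 0, t)`** (the `u₊`-component splits off on the left, same `y`). [cite: Xiong2013, §7 Lemma 7.1] -/
theorem nKlingen_eq_uPlus_mul (hσ : ∀ x, σ (σ x) = x) (y : R) (hy : σ y = -y) (z t : R) :
    nKlingen R σ hσ y hy z t = uPlus R σ hσ z * nKlingen R σ hσ y hy 0 t := by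
  rw [uPlus_eq_nKlingen hσ z, nKlingen_mul hσ]
  congr 1 <;> simp

/-- `n_Q` letters with equal coordinates are equal (proof-irrelevance in the skewness witness). [cite: Xiong2013, §7 Lemma 7.1] -/
theorem nKlingen_congr (hσ : ∀ x, σ (σ x) = x) {y y' : R} {hy : σ y = -y} {hy' : σ y' = -y'} {z z' t t' : R}
    (h1 : y = y') (h2 : z = z') (h3 : t = t') : nKlingen R σ hσ y hy z t = nKlingen R σ hσ y' hy' z' t' := by
  subst h1 h2 h3; rfl

/-- **matrix of `ξ m_Q(a,b) ξ⁻¹` for upper-triangular `b`**: `(b₀₀ 0 0 b₀₁; 0 σ(a⁻¹) 0 0; 0 0 a 0; 0 0 0 b₁₁)` — upper triangular, i.e. in the Siegel parabolic, with `e₂`-block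
`diag(b₀₀, σ(a⁻¹))`. [cite: Xiong2013, §4 Prop. 4.1] [cite: GanTakeda2011SiegelWeil, §7.2 p. 23] -/
theorem coe_weylXi_conj_klingenLevi_of_upper (hσ : ∀ x, σ (σ x) = x) (a : Rˣ) {b : unitaryGroupOfForm σ ((StdForm.antidiagonal 2).over R)}
    (hb : ((b : GL (Fin 2) R) : Matrix (Fin 2) (Fin 2) R) 1 0 = 0) :
    ((((weylXi R σ * klingenLevi R σ hσ a b * (weylXi R σ)⁻¹ : unitaryGroupOfForm σ _)) : GL (Fin 4) R) : Matrix (Fin 4) (Fin 4) R) =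
      !![((b : GL (Fin 2) R) : Matrix (Fin 2) (Fin 2) R) 0 0, 0, 0, ((b : GL (Fin 2) R) : Matrix (Fin 2) (Fin 2) R) 0 1;
         0, σ ((a⁻¹ : Rˣ) : R), 0, 0;
         0, 0, (a : R), 0;
         0, 0, 0, ((b : GL (Fin 2) R) : Matrix (Fin 2) (Fin 2) R) 1 1] := by
  rw [Subgroup.coe_mul, Units.val_mul, Subgroup.coe_mul, Units.val_mul, coe_weylXi, coe_klingenLevi, coe_weylXi_inv]
  ext i j
  fin_cases i <;> fin_cases j <;> simp [weylXiM, klingenLeviM, Matrix.mul_apply, Fin.sum_univ_four, hb]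

/-- … which is upper (hence block-upper) triangular. [cite: Xiong2013, §4 Prop. 4.1] -/
theorem blockTriangular_weylXi_conj_klingenLevi_of_upper (hσ : ∀ x, σ (σ x) = x) (a : Rˣ) {b : unitaryGroupOfForm σ ((StdForm.antidiagonal 2).over R)}
    (hb : ((b : GL (Fin 2) R) : Matrix (Fin 2) (Fin 2) R) 1 0 = 0) :
    ((((weylXi R σ * klingenLevi R σ hσ a b * (weylXi R σ)⁻¹ : unitaryGroupOfForm σ _)) : GL (Fin 4) R) : Matrix (Fin 4) (Fin 4) R).BlockTriangular id := by
  rw [coe_weylXi_conj_klingenLevi_of_upper hσ a hb]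
  intro i j hij
  fin_cases i <;> fin_cases j <;> first | exact absurd hij (by decide) | simp

/-- … and its `e₂`-reindexed upper-left block is `diag(b₀₀, σ(a⁻¹))`, of determinant `b₀₀ · σ(a⁻¹)`. [cite: Xiong2013, §4 Prop. 4.1] -/
theorem det_toBlocks₁₁_weylXi_conj_klingenLevi_of_upper (hσ : ∀ x, σ (σ x) = x) (a : Rˣ) {b : unitaryGroupOfForm σ ((StdForm.antidiagonal 2).over R)}
    (hb : ((b : GL (Fin 2) R) : Matrix (Fin 2) (Fin 2) R) 1 0 = 0) :
    ((Matrix.reindex (e₂ (n := 2)).symm (e₂ (n := 2)).symm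
        ((((weylXi R σ * klingenLevi R σ hσ a b * (weylXi R σ)⁻¹ : unitaryGroupOfForm σ _)) : GL (Fin 4) R) : Matrix (Fin 4) (Fin 4) R)).toBlocks₁₁).det =
      ((b : GL (Fin 2) R) : Matrix (Fin 2) (Fin 2) R) 0 0 * σ ((a⁻¹ : Rˣ) : R) := by
  have h11 : (Matrix.reindex (e₂ (n := 2)).symm (e₂ (n := 2)).symm
      ((((weylXi R σ * klingenLevi R σ hσ a b * (weylXi R σ)⁻¹ : unitaryGroupOfForm σ _)) : GL (Fin 4) R) : Matrix (Fin 4) (Fin 4) R)).toBlocks₁₁ =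
      !![((b : GL (Fin 2) R) : Matrix (Fin 2) (Fin 2) R) 0 0, 0; 0, σ ((a⁻¹ : Rˣ) : R)] := by
    rw [coe_weylXi_conj_klingenLevi_of_upper hσ a hb]
    ext i j
    fin_cases i <;> fin_cases j <;> rfl
  rw [h11, Matrix.det_fin_two_of]
  ring

/-- the `e₂`-reindexed upper-left block of `u_{e₁−e₂}(t)` is `(1 t; 0 1)`, of determinant `1` (★ F4-1 §1 via `u_{e₁−e₂}(t) = n_Q(0,0,t)`). [cite: HarrisKudlaSweet1996, §1 (1.11)] -/
theorem det_toBlocks₁₁_uMinusM (t : R) :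
    ((Matrix.reindex (e₂ (n := 2)).symm (e₂ (n := 2)).symm (uMinusM R σ t)).toBlocks₁₁).det = 1 := by
  have h11 : (Matrix.reindex (e₂ (n := 2)).symm (e₂ (n := 2)).symm (uMinusM R σ t)).toBlocks₁₁ = !![1, t; 0, 1] := by
    ext i j
    fin_cases i <;> fin_cases j <;> rfl
  rw [h11, Matrix.det_fin_two_of]
  ring

/-- `u_{e₁−e₂}(t)` is upper triangular. [cite: HarrisKudlaSweet1996, §1 (1.11)] -/
theorem uMinusM_blockTriangular (t : R) : (uMinusM R σ t).BlockTriangular id := by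
  intro i j hij
  fin_cases i <;> fin_cases j <;> first | exact absurd hij (by decide) | simp [uMinusM]

end Generic

/-! ## §1 Through the transport (`n = 2`) -/

variable {L : Type} [Field L] [NumberField L] [IsCMField L]
variable {N M : ℕ} {e : Fin N × Fin M ≃ Fin 2}
  {dV : Fin N → L} {hdV : ∀ i, IsCMField.complexConj L (dV i) = dV i}
  {dW : Fin M → L} {hdW : ∀ i, IsCMField.complexConj L (dW i) = dW i}

section Transport

variable {SA : GL (Fin (2 + 2)) (AdeleRing (𝓞 L) L)}
  {Ψ : (quasiSplit (Fp L) L (IsCMField.complexConj L) (2 + 2)).Adelic ≃ₜ* HA L e dV hdV dW hdW} {X Y : Matrix (Fin 2) (Fin 2) (Fp L)} {a : Fp L}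
  (hΨ : ∀ g : (quasiSplit (Fp L) L (IsCMField.complexConj L) (2 + 2)).Adelic,
    (((Ψ g : HA L e dV hdV dW hdW) : GL (Fin (2 + 2)) (AdeleRing (𝓞 L) L)) : Matrix (Fin (2 + 2)) (Fin (2 + 2)) (AdeleRing (𝓞 L) L)) =
      (SA : Matrix (Fin (2 + 2)) (Fin (2 + 2)) (AdeleRing (𝓞 L) L)) *
        ((adelicVal (Fp L) L (IsCMField.complexConj L) (2 + 2) _ g : GL (Fin (2 + 2)) (AdeleRing (𝓞 L) L)) :
          Matrix (Fin (2 + 2)) (Fin (2 + 2)) (AdeleRing (𝓞 L) L)) *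
        ((SA⁻¹ : GL (Fin (2 + 2)) (AdeleRing (𝓞 L) L)) : Matrix (Fin (2 + 2)) (Fin (2 + 2)) (AdeleRing (𝓞 L) L)))
  (ha : a + a = 1)
  (hSA : Matrix.reindex (e₂ (n := 2)).symm (e₂ (n := 2)).symm (SA : Matrix (Fin (2 + 2)) (Fin (2 + 2)) (AdeleRing (𝓞 L) L)) =
    Matrix.fromBlocks (1 : Matrix (Fin 2) (Fin 2) (AdeleRing (𝓞 L) L)) (X.map ((algebraMap L (AdeleRing (𝓞 L) L)).comp (algebraMap (Fp L) L))) 1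
      (-(X.map ((algebraMap L (AdeleRing (𝓞 L) L)).comp (algebraMap (Fp L) L)))))
  (hSAi : Matrix.reindex (e₂ (n := 2)).symm (e₂ (n := 2)).symm ((SA⁻¹ : GL (Fin (2 + 2)) (AdeleRing (𝓞 L) L)) : Matrix (Fin (2 + 2)) (Fin (2 + 2)) (AdeleRing (𝓞 L) L)) =
    Matrix.fromBlocks ((a • (1 : Matrix (Fin 2) (Fin 2) (Fp L))).map ((algebraMap L (AdeleRing (𝓞 L) L)).comp (algebraMap (Fp L) L)))
      ((a • (1 : Matrix (Fin 2) (Fin 2) (Fp L))).map ((algebraMap L (AdeleRing (𝓞 L) L)).comp (algebraMap (Fp L) L)))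
      (Y.map ((algebraMap L (AdeleRing (𝓞 L) L)).comp (algebraMap (Fp L) L)))
      (-(Y.map ((algebraMap L (AdeleRing (𝓞 L) L)).comp (algebraMap (Fp L) L)))))
  (hΨP : ∀ b : (quasiSplit (Fp L) L (IsCMField.complexConj L) (2 + 2)).Adelic,
    ((adelicVal (Fp L) L (IsCMField.complexConj L) (2 + 2) _ b : GL (Fin (2 + 2)) (AdeleRing (𝓞 L) L)) :
        Matrix (Fin (2 + 2)) (Fin (2 + 2)) (AdeleRing (𝓞 L) L)).BlockTriangular id →
      IsSiegelDelta L e dV hdV dW hdW (Ψ b))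

include hΨP in
/-- **`Ψ(ξ m_Q(a,b) ξ⁻¹) ∈ P_Δ(𝔸)`** for `a ∈ 𝔸_L^×` and upper-triangular `b ∈ U(J₂)(𝔸)` (clause (T4)). [cite: Xiong2013, §4 Prop. 4.1] [cite: MoeglinWaldspurger1995, II.1.7] -/
theorem isSiegelDelta_transport_weylXi_conj_klingenLevi (a' : (AdeleRing (𝓞 L) L)ˣ)
    {b : unitaryGroupOfForm (conjAdele (Fp L) L (IsCMField.complexConj L)) ((StdForm.antidiagonal 2).over (AdeleRing (𝓞 L) L))}
    (hb : ((b : GL (Fin 2) (AdeleRing (𝓞 L) L)) : Matrix (Fin 2) (Fin 2) (AdeleRing (𝓞 L) L)) 1 0 = 0) :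
    IsSiegelDelta L e dV hdV dW hdW (Ψ (jAdelic L 4
      (weylXi (AdeleRing (𝓞 L) L) (conjAdele (Fp L) L (IsCMField.complexConj L)) *
        klingenLevi (AdeleRing (𝓞 L) L) (conjAdele (Fp L) L (IsCMField.complexConj L)) (conjAdele_conjAdele' L) a' b *
        (weylXi (AdeleRing (𝓞 L) L) (conjAdele (Fp L) L (IsCMField.complexConj L)))⁻¹))) := by
  refine hΨP _ ?_
  rw [coe_adelicVal_jAdelic]
  exact blockTriangular_weylXi_conj_klingenLevi_of_upper (conjAdele_conjAdele' L) a' hb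

include hΨ ha hSA hSAi in
/-- **`det_Δ(Ψ(ξ m_Q(a,b) ξ⁻¹)) = b₀₀ · σ(a⁻¹)`** — the inducing character of term 2 reads `χ(b₀₀ σ(a)⁻¹)‖b₀₀ σ(a)⁻¹‖^{s+1}` before the substitution modulus
(★ F3′ `detDelta_transport_of_blockTriangular`). [cite: Xiong2013, §4 Prop. 4.1] [cite: GanTakeda2011SiegelWeil, §7.2 p. 23] [cite: HarrisKudlaSweet1996, §1 (1.15)] -/
theorem detDelta_transport_weylXi_conj_klingenLevi (a' : (AdeleRing (𝓞 L) L)ˣ)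
    {b : unitaryGroupOfForm (conjAdele (Fp L) L (IsCMField.complexConj L)) ((StdForm.antidiagonal 2).over (AdeleRing (𝓞 L) L))}
    (hb : ((b : GL (Fin 2) (AdeleRing (𝓞 L) L)) : Matrix (Fin 2) (Fin 2) (AdeleRing (𝓞 L) L)) 1 0 = 0) :
    detDelta L e dV hdV dW hdW (Ψ (jAdelic L 4
      (weylXi (AdeleRing (𝓞 L) L) (conjAdele (Fp L) L (IsCMField.complexConj L)) *
        klingenLevi (AdeleRing (𝓞 L) L) (conjAdele (Fp L) L (IsCMField.complexConj L)) (conjAdele_conjAdele' L) a' b *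
        (weylXi (AdeleRing (𝓞 L) L) (conjAdele (Fp L) L (IsCMField.complexConj L)))⁻¹))) =
      ((b : GL (Fin 2) (AdeleRing (𝓞 L) L)) : Matrix (Fin 2) (Fin 2) (AdeleRing (𝓞 L) L)) 0 0 * conjAdele (Fp L) L (IsCMField.complexConj L) ((a'⁻¹ : (AdeleRing (𝓞 L) L)ˣ) : AdeleRing (𝓞 L) L) := by
  rw [detDelta_transport_of_blockTriangular hΨ ha hSA hSAi (by rw [coe_adelicVal_jAdelic]; exact blockTriangular_weylXi_conj_klingenLevi_of_upper (conjAdele_conjAdele' L) a' hb),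
    coe_adelicVal_jAdelic]
  exact det_toBlocks₁₁_weylXi_conj_klingenLevi_of_upper (conjAdele_conjAdele' L) a' hb

include hΨ ha hSA hSAi hΨP in
/-- **`Ψ(ξ u₊(z) ξ⁻¹) = Ψ(u_{e₁−e₂}(−σz))` is invisible to Siegel sections** (block unipotent; ★ F3′ `apply_transport_mul`). [cite: GanTakeda2011SiegelWeil, §7.2 p. 23] -/
theorem apply_transport_weylXi_conj_uPlus_mul {χ : HeckeCharacter L} {s : ℂ} {f : HA L e dV hdV dW hdW → ℂ} (hf : IsSiegelDeltaSection L e dV hdV dW hdW χ s f)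
    (z : AdeleRing (𝓞 L) L) (h : HA L e dV hdV dW hdW) :
    f (Ψ (jAdelic L 4 (weylXi (AdeleRing (𝓞 L) L) (conjAdele (Fp L) L (IsCMField.complexConj L)) *
        uPlus (AdeleRing (𝓞 L) L) (conjAdele (Fp L) L (IsCMField.complexConj L)) (conjAdele_conjAdele' L) z *
        (weylXi (AdeleRing (𝓞 L) L) (conjAdele (Fp L) L (IsCMField.complexConj L)))⁻¹)) * h) = f h := by
  rw [weylXi_mul_uPlus_mul_inv]
  refine apply_transport_mul hΨ ha hSA hSAi hΨP hf ?_ ?_ h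
  · rw [coe_adelicVal_jAdelic, coe_uMinus]; exact uMinusM_blockTriangular _
  · rw [coe_adelicVal_jAdelic, coe_uMinus]; exact det_toBlocks₁₁_uMinusM _

/-! ## §2 The Klingen-Levi law of the inner section (hypothesis-first) -/

include hΨ ha hSA hSAi hΨP in
/-- **(Q2) F5-c — THE KLINGEN-LEVI LAW OF THE INNER SECTION OF THE `ξ`-CELL.**  Let `F(x) = ∫ f(Ψ(ξ) · Ψ(n_Q(y_p, 0, t_p)) · x) dμ(p)` (`hF`; the inner section after the
`u₊`-integration, over an abstract parameter space `(P, μ)` with skew coordinate `y_p` and coordinate `t_p`), `a ∈ 𝔸_L^×`, `b ∈ U(J₂)(𝔸)` upper triangular, `c : P → P` the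
substitution `(y, t) ↦ (a⁻¹σ(a)⁻¹ y + z′σ(t′), a⁻¹ t b₀₀)` (`hcy`, `hct`) with modulus `δ` (`hscale`, BY VALUE: Haar gives `δ`, the product formula makes it `1` at rational
points).  THEN
  `F(Ψ(m_Q(a,b)) · x) = siegelDeltaCharacter χ s (Ψ(ξ m_Q(a,b) ξ⁻¹)) · δ · F(x)`
(`ξ n m = (ξ m ξ⁻¹)(ξ u₊(z′) ξ⁻¹) ξ n_Q(y′,0,t′)`, the first factor through the section property — `det_Δ = b₀₀ σ(a⁻¹)`, §1 — the second invisible).  For `a = 1`: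
`g′ ↦ F(Ψ(m_Q(1,g′)) x)` is a BOREL SECTION of `U(J₂)(𝔸)` (E1's `U(Φ₂)`) — term 2 of `E_Q` is E1's Borel Eisenstein series (file F5).
[cite: MoeglinWaldspurger1995, II.1.7] [cite: Xiong2013, §4 Prop. 4.1] [cite: GanTakeda2011SiegelWeil, §7.2 p. 23] -/
theorem klingenInner_levi_law {P : Type*} [MeasurableSpace P] (μ : Measure P)
    (yf : P → AdeleRing (𝓞 L) L) (hyf : ∀ p, conjAdele (Fp L) L (IsCMField.complexConj L) (yf p) = -(yf p)) (tf : P → AdeleRing (𝓞 L) L)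
    (a' : (AdeleRing (𝓞 L) L)ˣ)
    {b : unitaryGroupOfForm (conjAdele (Fp L) L (IsCMField.complexConj L)) ((StdForm.antidiagonal 2).over (AdeleRing (𝓞 L) L))}
    (hb : ((b : GL (Fin 2) (AdeleRing (𝓞 L) L)) : Matrix (Fin 2) (Fin 2) (AdeleRing (𝓞 L) L)) 1 0 = 0)
    (c : P → P)
    (hcy : ∀ p, yf (c p) = ((a'⁻¹ : (AdeleRing (𝓞 L) L)ˣ) : AdeleRing (𝓞 L) L) * conjAdele (Fp L) L (IsCMField.complexConj L) ((a'⁻¹ : (AdeleRing (𝓞 L) L)ˣ) : AdeleRing (𝓞 L) L) * yf p +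
      ((a'⁻¹ : (AdeleRing (𝓞 L) L)ˣ) : AdeleRing (𝓞 L) L) * tf p * ((b : GL (Fin 2) (AdeleRing (𝓞 L) L)) : Matrix (Fin 2) (Fin 2) (AdeleRing (𝓞 L) L)) 0 1 *
        conjAdele (Fp L) L (IsCMField.complexConj L)
          (((a'⁻¹ : (AdeleRing (𝓞 L) L)ˣ) : AdeleRing (𝓞 L) L) * tf p * ((b : GL (Fin 2) (AdeleRing (𝓞 L) L)) : Matrix (Fin 2) (Fin 2) (AdeleRing (𝓞 L) L)) 0 0))
    (hct : ∀ p, tf (c p) = ((a'⁻¹ : (AdeleRing (𝓞 L) L)ˣ) : AdeleRing (𝓞 L) L) * tf p * ((b : GL (Fin 2) (AdeleRing (𝓞 L) L)) : Matrix (Fin 2) (Fin 2) (AdeleRing (𝓞 L) L)) 0 0)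
    {χ : HeckeCharacter L} {s : ℂ} {f : HA L e dV hdV dW hdW → ℂ} (hf : IsSiegelDeltaSection L e dV hdV dW hdW χ s f)
    (F : HA L e dV hdV dW hdW → ℂ)
    (hF : ∀ x, F x = ∫ p, f (Ψ (jAdelic L 4 (weylXi (AdeleRing (𝓞 L) L) (conjAdele (Fp L) L (IsCMField.complexConj L)))) *
        Ψ (jAdelic L 4 (nKlingen (AdeleRing (𝓞 L) L) (conjAdele (Fp L) L (IsCMField.complexConj L)) (conjAdele_conjAdele' L) (yf p) (hyf p) 0 (tf p))) * x) ∂μ)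
    (δ : ℂ)
    (hscale : ∀ x, ∫ p, f (Ψ (jAdelic L 4 (weylXi (AdeleRing (𝓞 L) L) (conjAdele (Fp L) L (IsCMField.complexConj L)))) *
        Ψ (jAdelic L 4 (nKlingen (AdeleRing (𝓞 L) L) (conjAdele (Fp L) L (IsCMField.complexConj L)) (conjAdele_conjAdele' L) (yf (c p)) (hyf (c p)) 0 (tf (c p)))) *
          x) ∂μ =
      δ * ∫ p, f (Ψ (jAdelic L 4 (weylXi (AdeleRing (𝓞 L) L) (conjAdele (Fp L) L (IsCMField.complexConj L)))) *
        Ψ (jAdelic L 4 (nKlingen (AdeleRing (𝓞 L) L) (conjAdele (Fp L) L (IsCMField.complexConj L)) (conjAdele_conjAdele' L) (yf p) (hyf p) 0 (tf p))) * x) ∂μ)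
    (x : HA L e dV hdV dW hdW) :
    F (Ψ (jAdelic L 4 (klingenLevi (AdeleRing (𝓞 L) L) (conjAdele (Fp L) L (IsCMField.complexConj L)) (conjAdele_conjAdele' L) a' b)) * x) =
      siegelDeltaCharacter L e dV hdV dW hdW χ s (Ψ (jAdelic L 4
        (weylXi (AdeleRing (𝓞 L) L) (conjAdele (Fp L) L (IsCMField.complexConj L)) *
          klingenLevi (AdeleRing (𝓞 L) L) (conjAdele (Fp L) L (IsCMField.complexConj L)) (conjAdele_conjAdele' L) a' b *
          (weylXi (AdeleRing (𝓞 L) L) (conjAdele (Fp L) L (IsCMField.complexConj L)))⁻¹))) * δ * F x := by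
  -- abbreviations (local, by `have` equations on opaque letters to keep terms small)
  obtain ⟨ξ', hξ'⟩ : ∃ ξ' : unitaryGroupOfForm (conjAdele (Fp L) L (IsCMField.complexConj L)) ((StdForm.antidiagonal 4).over (AdeleRing (𝓞 L) L)),
      ξ' = weylXi (AdeleRing (𝓞 L) L) (conjAdele (Fp L) L (IsCMField.complexConj L)) := ⟨_, rfl⟩
  obtain ⟨m, hm⟩ : ∃ m : unitaryGroupOfForm (conjAdele (Fp L) L (IsCMField.complexConj L)) ((StdForm.antidiagonal 4).over (AdeleRing (𝓞 L) L)),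
      m = klingenLevi (AdeleRing (𝓞 L) L) (conjAdele (Fp L) L (IsCMField.complexConj L)) (conjAdele_conjAdele' L) a' b := ⟨_, rfl⟩
  -- the pointwise identity of the integrands
  have hpt : ∀ p, f (Ψ (jAdelic L 4 ξ') *
      Ψ (jAdelic L 4 (nKlingen (AdeleRing (𝓞 L) L) (conjAdele (Fp L) L (IsCMField.complexConj L)) (conjAdele_conjAdele' L) (yf p) (hyf p) 0 (tf p))) *
        (Ψ (jAdelic L 4 m) * x)) =
      siegelDeltaCharacter L e dV hdV dW hdW χ s (Ψ (jAdelic L 4 (ξ' * m * ξ'⁻¹))) *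
        f (Ψ (jAdelic L 4 ξ') *
          Ψ (jAdelic L 4 (nKlingen (AdeleRing (𝓞 L) L) (conjAdele (Fp L) L (IsCMField.complexConj L)) (conjAdele_conjAdele' L)
            (yf (c p)) (hyf (c p)) 0 (tf (c p)))) * x) := by
    intro p
    -- the group identity `ξ n m = (ξ m ξ⁻¹) · (ξ u₊(z′) ξ⁻¹) · (ξ n_Q(y′,0,t′))`
    have hnm := nKlingen_mul_klingenLevi_of_upper (conjAdele_conjAdele' L) a' hb (yf p) (hyf p) (tf p)
    rw [← hm] at hnm
    have hsplit := nKlingen_eq_uPlus_mul (conjAdele_conjAdele' L)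
      (((a'⁻¹ : (AdeleRing (𝓞 L) L)ˣ) : AdeleRing (𝓞 L) L) * conjAdele (Fp L) L (IsCMField.complexConj L) ((a'⁻¹ : (AdeleRing (𝓞 L) L)ˣ) : AdeleRing (𝓞 L) L) * yf p +
        ((a'⁻¹ : (AdeleRing (𝓞 L) L)ˣ) : AdeleRing (𝓞 L) L) * tf p * ((b : GL (Fin 2) (AdeleRing (𝓞 L) L)) : Matrix (Fin 2) (Fin 2) (AdeleRing (𝓞 L) L)) 0 1 *
          conjAdele (Fp L) L (IsCMField.complexConj L)
            (((a'⁻¹ : (AdeleRing (𝓞 L) L)ˣ) : AdeleRing (𝓞 L) L) * tf p * ((b : GL (Fin 2) (AdeleRing (𝓞 L) L)) : Matrix (Fin 2) (Fin 2) (AdeleRing (𝓞 L) L)) 0 0))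
      (skew_yPrime (conjAdele_conjAdele' L) a' hb (hyf p) (tf p))
      (((a'⁻¹ : (AdeleRing (𝓞 L) L)ˣ) : AdeleRing (𝓞 L) L) * tf p * ((b : GL (Fin 2) (AdeleRing (𝓞 L) L)) : Matrix (Fin 2) (Fin 2) (AdeleRing (𝓞 L) L)) 0 1)
      (((a'⁻¹ : (AdeleRing (𝓞 L) L)ˣ) : AdeleRing (𝓞 L) L) * tf p * ((b : GL (Fin 2) (AdeleRing (𝓞 L) L)) : Matrix (Fin 2) (Fin 2) (AdeleRing (𝓞 L) L)) 0 0)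
    -- identify `n_Q(y′,0,t′)` with `n_Q(y (c p), 0, t (c p))`
    have hcoord : nKlingen (AdeleRing (𝓞 L) L) (conjAdele (Fp L) L (IsCMField.complexConj L)) (conjAdele_conjAdele' L)
        (((a'⁻¹ : (AdeleRing (𝓞 L) L)ˣ) : AdeleRing (𝓞 L) L) * conjAdele (Fp L) L (IsCMField.complexConj L) ((a'⁻¹ : (AdeleRing (𝓞 L) L)ˣ) : AdeleRing (𝓞 L) L) * yf p +
          ((a'⁻¹ : (AdeleRing (𝓞 L) L)ˣ) : AdeleRing (𝓞 L) L) * tf p * ((b : GL (Fin 2) (AdeleRing (𝓞 L) L)) : Matrix (Fin 2) (Fin 2) (AdeleRing (𝓞 L) L)) 0 1 *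
            conjAdele (Fp L) L (IsCMField.complexConj L)
              (((a'⁻¹ : (AdeleRing (𝓞 L) L)ˣ) : AdeleRing (𝓞 L) L) * tf p * ((b : GL (Fin 2) (AdeleRing (𝓞 L) L)) : Matrix (Fin 2) (Fin 2) (AdeleRing (𝓞 L) L)) 0 0))
        (skew_yPrime (conjAdele_conjAdele' L) a' hb (hyf p) (tf p)) 0
        (((a'⁻¹ : (AdeleRing (𝓞 L) L)ˣ) : AdeleRing (𝓞 L) L) * tf p * ((b : GL (Fin 2) (AdeleRing (𝓞 L) L)) : Matrix (Fin 2) (Fin 2) (AdeleRing (𝓞 L) L)) 0 0) =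
      nKlingen (AdeleRing (𝓞 L) L) (conjAdele (Fp L) L (IsCMField.complexConj L)) (conjAdele_conjAdele' L) (yf (c p)) (hyf (c p)) 0 (tf (c p)) := by
      exact nKlingen_congr (conjAdele_conjAdele' L) (hcy p).symm rfl (hct p).symm
    -- assemble: `ξ' * n * (m * x) = (ξ' m ξ'⁻¹) * ((ξ' u₊ ξ'⁻¹) * (ξ' * n″ * x))`
    have hgrp : Ψ (jAdelic L 4 ξ') *
        Ψ (jAdelic L 4 (nKlingen (AdeleRing (𝓞 L) L) (conjAdele (Fp L) L (IsCMField.complexConj L)) (conjAdele_conjAdele' L) (yf p) (hyf p) 0 (tf p))) *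
          (Ψ (jAdelic L 4 m) * x) =
        Ψ (jAdelic L 4 (ξ' * m * ξ'⁻¹)) *
          (Ψ (jAdelic L 4 (ξ' * uPlus (AdeleRing (𝓞 L) L) (conjAdele (Fp L) L (IsCMField.complexConj L)) (conjAdele_conjAdele' L)
              (((a'⁻¹ : (AdeleRing (𝓞 L) L)ˣ) : AdeleRing (𝓞 L) L) * tf p * ((b : GL (Fin 2) (AdeleRing (𝓞 L) L)) : Matrix (Fin 2) (Fin 2) (AdeleRing (𝓞 L) L)) 0 1) * ξ'⁻¹)) *
            (Ψ (jAdelic L 4 ξ') *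
              Ψ (jAdelic L 4 (nKlingen (AdeleRing (𝓞 L) L) (conjAdele (Fp L) L (IsCMField.complexConj L)) (conjAdele_conjAdele' L)
                (yf (c p)) (hyf (c p)) 0 (tf (c p)))) * x)) := by
      rw [← hcoord]
      have key : ξ' * nKlingen (AdeleRing (𝓞 L) L) (conjAdele (Fp L) L (IsCMField.complexConj L)) (conjAdele_conjAdele' L) (yf p) (hyf p) 0 (tf p) * m =
          (ξ' * m * ξ'⁻¹) * ((ξ' * uPlus (AdeleRing (𝓞 L) L) (conjAdele (Fp L) L (IsCMField.complexConj L)) (conjAdele_conjAdele' L)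
              (((a'⁻¹ : (AdeleRing (𝓞 L) L)ˣ) : AdeleRing (𝓞 L) L) * tf p * ((b : GL (Fin 2) (AdeleRing (𝓞 L) L)) : Matrix (Fin 2) (Fin 2) (AdeleRing (𝓞 L) L)) 0 1) * ξ'⁻¹) *
            (ξ' * nKlingen (AdeleRing (𝓞 L) L) (conjAdele (Fp L) L (IsCMField.complexConj L)) (conjAdele_conjAdele' L)
              (((a'⁻¹ : (AdeleRing (𝓞 L) L)ˣ) : AdeleRing (𝓞 L) L) * conjAdele (Fp L) L (IsCMField.complexConj L) ((a'⁻¹ : (AdeleRing (𝓞 L) L)ˣ) : AdeleRing (𝓞 L) L) * yf p +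
                ((a'⁻¹ : (AdeleRing (𝓞 L) L)ˣ) : AdeleRing (𝓞 L) L) * tf p * ((b : GL (Fin 2) (AdeleRing (𝓞 L) L)) : Matrix (Fin 2) (Fin 2) (AdeleRing (𝓞 L) L)) 0 1 *
                  conjAdele (Fp L) L (IsCMField.complexConj L)
                    (((a'⁻¹ : (AdeleRing (𝓞 L) L)ˣ) : AdeleRing (𝓞 L) L) * tf p * ((b : GL (Fin 2) (AdeleRing (𝓞 L) L)) : Matrix (Fin 2) (Fin 2) (AdeleRing (𝓞 L) L)) 0 0))
              (skew_yPrime (conjAdele_conjAdele' L) a' hb (hyf p) (tf p)) 0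
              (((a'⁻¹ : (AdeleRing (𝓞 L) L)ˣ) : AdeleRing (𝓞 L) L) * tf p * ((b : GL (Fin 2) (AdeleRing (𝓞 L) L)) : Matrix (Fin 2) (Fin 2) (AdeleRing (𝓞 L) L)) 0 0))) := by
        rw [mul_assoc ξ', hnm, hsplit]
        group
      have hmap : ∀ u v : unitaryGroupOfForm (conjAdele (Fp L) L (IsCMField.complexConj L)) ((StdForm.antidiagonal 4).over (AdeleRing (𝓞 L) L)),
          Ψ (jAdelic L 4 (u * v)) = Ψ (jAdelic L 4 u) * Ψ (jAdelic L 4 v) := fun u v => by rw [map_mul, map_mul]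
      calc Ψ (jAdelic L 4 ξ') * Ψ (jAdelic L 4 (nKlingen (AdeleRing (𝓞 L) L) (conjAdele (Fp L) L (IsCMField.complexConj L)) (conjAdele_conjAdele' L)
              (yf p) (hyf p) 0 (tf p))) * (Ψ (jAdelic L 4 m) * x)
          = Ψ (jAdelic L 4 (ξ' * nKlingen (AdeleRing (𝓞 L) L) (conjAdele (Fp L) L (IsCMField.complexConj L)) (conjAdele_conjAdele' L) (yf p) (hyf p) 0 (tf p) * m)) * x := by
            rw [hmap, hmap]; simp only [mul_assoc]
        _ = _ := by
            rw [key, hmap (ξ' * m * ξ'⁻¹), hmap (ξ' * uPlus (AdeleRing (𝓞 L) L) (conjAdele (Fp L) L (IsCMField.complexConj L)) (conjAdele_conjAdele' L)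
                (((a'⁻¹ : (AdeleRing (𝓞 L) L)ˣ) : AdeleRing (𝓞 L) L) * tf p * ((b : GL (Fin 2) (AdeleRing (𝓞 L) L)) : Matrix (Fin 2) (Fin 2) (AdeleRing (𝓞 L) L)) 0 1) * ξ'⁻¹),
              hmap ξ', mul_assoc (Ψ (jAdelic L 4 (ξ' * m * ξ'⁻¹))),
              mul_assoc (Ψ (jAdelic L 4 (ξ' * uPlus (AdeleRing (𝓞 L) L) (conjAdele (Fp L) L (IsCMField.complexConj L)) (conjAdele_conjAdele' L)
                (((a'⁻¹ : (AdeleRing (𝓞 L) L)ˣ) : AdeleRing (𝓞 L) L) * tf p * ((b : GL (Fin 2) (AdeleRing (𝓞 L) L)) : Matrix (Fin 2) (Fin 2) (AdeleRing (𝓞 L) L)) 0 1) * ξ'⁻¹)))]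
    rw [hgrp, hf _ (by rw [hξ', hm]; exact isSiegelDelta_transport_weylXi_conj_klingenLevi hΨP a' hb),
      show Ψ (jAdelic L 4 (ξ' * uPlus (AdeleRing (𝓞 L) L) (conjAdele (Fp L) L (IsCMField.complexConj L)) (conjAdele_conjAdele' L)
          (((a'⁻¹ : (AdeleRing (𝓞 L) L)ˣ) : AdeleRing (𝓞 L) L) * tf p * ((b : GL (Fin 2) (AdeleRing (𝓞 L) L)) : Matrix (Fin 2) (Fin 2) (AdeleRing (𝓞 L) L)) 0 1) * ξ'⁻¹)) *
          (Ψ (jAdelic L 4 ξ') * Ψ (jAdelic L 4 (nKlingen (AdeleRing (𝓞 L) L) (conjAdele (Fp L) L (IsCMField.complexConj L)) (conjAdele_conjAdele' L)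
            (yf (c p)) (hyf (c p)) 0 (tf (c p)))) * x) =
        Ψ (jAdelic L 4 (weylXi (AdeleRing (𝓞 L) L) (conjAdele (Fp L) L (IsCMField.complexConj L)) *
            uPlus (AdeleRing (𝓞 L) L) (conjAdele (Fp L) L (IsCMField.complexConj L)) (conjAdele_conjAdele' L)
              (((a'⁻¹ : (AdeleRing (𝓞 L) L)ˣ) : AdeleRing (𝓞 L) L) * tf p * ((b : GL (Fin 2) (AdeleRing (𝓞 L) L)) : Matrix (Fin 2) (Fin 2) (AdeleRing (𝓞 L) L)) 0 1) *
            (weylXi (AdeleRing (𝓞 L) L) (conjAdele (Fp L) L (IsCMField.complexConj L)))⁻¹)) *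
          (Ψ (jAdelic L 4 ξ') * Ψ (jAdelic L 4 (nKlingen (AdeleRing (𝓞 L) L) (conjAdele (Fp L) L (IsCMField.complexConj L)) (conjAdele_conjAdele' L)
            (yf (c p)) (hyf (c p)) 0 (tf (c p)))) * x) by rw [hξ'],
      apply_transport_weylXi_conj_uPlus_mul hΨ ha hSA hSAi hΨP hf]
  -- integrate
  rw [hF, hF x]
  simp_rw [← hξ', ← hm] at hscale ⊢
  simp_rw [hpt]
  rw [integral_const_mul, hscale x]
  ring

end Transport

end Summit.HodgeConjecture.HodgeConjecture.Cruxes.HLiu418.K2LiuKlingenInnerSectionLeviLaw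

end
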